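import Mathlib
import HarnessLib
import Literature.Analysis.FluidPDE.SuitableWeak
import Literature.Analysis.FluidPDE.MildSolution
import Literature.Analysis.FluidPDE.SelfSimilar
import Summits.NavierStokesRegularity.NavierStokesRegularity.Theses.AngularGalerkinLadder

/-! # BC3 skeleton (birth line, v4 = KJ-18 repair) for crux `RungBlowupCofinal`
(item stmt-NavierStokesRegularity-19959, route `route-NavierStokesRegularity-AngularGalerkinLadder` №8, card K1;
planner ns-blowup-plan g21, 2026-08-27)

WHY v4. The registered v2 line (tree `Cruxes/RungBlowupCofinal/Lines/birth.lean`, sha16 7291ec516ffe3abf) typed the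
forward event as `RungForwardTypeIBlowup L` (sup-norm Type-I rate + decay of the DATUM only). Refuter g14's junk audit
KJ-18 (kernel p475616, `Theorems/RungBlowupCofinal/Negative/ForwardStubParasitic.lean`:
`rungForwardTypeIBlowup_parasitic (1 ≤ L)`, `rungForwardTypeIBlowup_two_parasitic`, `forwardBlowupCofinal_parasitic`,
`rungIsSingular_of_dss_extraction_stub`) showed that letter is INHABITED FOR THE WRONG REASON at every `L ≥ 1` by the
KNSS parasitic drift `u = −log(1−t)·e₀`, `∇p = −u′`, `d = 0` (a constant field is isotype `j = 1`; the datum is `0`), so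
`stub_forward_blowup_cofinal` and the BC5 stub were junk-true and `stub_dss_extraction : ∀ L, Forward L → RungIsSingular L`
silently asserted `∀ L ≥ 1, RungIsSingular L`. Class: stub-misstated (the crux item 19959 is untouched).

THE REPAIR (planner's decision among KJ-18 §3's options, both adopted, plus the decomposition change J caveat (i) asked for):
* `R1` finite energy on EVERY slice `MemLp (u t) 2 volume` (kills the drift and every harmonic-polynomial pressure driver);
* `R2` the ORIGIN-CENTRED Type-I envelope `‖u t x‖ ≤ C / (‖x‖ + √(T − t))` on `[0,T) × ℝ³` replacing the sup-norm
  `IsTypeIBlowup` (kills spatially uniform flows, pins the singular point to the truncation centre — the only point about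
  which `NS_L` is scaling-covariant — and is the forward image of `HasTypeIDecay`, KNSS (1.6));
* the forward letter now CARRIES ITS TANGENT FLOW: along some sequence of scales `λₙ → 0` the Leray rescalings about
  `(T, 0)`, `λₙ u(T + λₙ² s, λₙ y)` (tree `nsRescale`), converge pointwise on the open past to a NONTRIVIAL rotated-DSS field
  `v` (tree `IsRotatedDSS`, factor `c > 1`). This is exactly what a Chen–Hou-type computer-assisted construction delivers
  (profile + stability ⇒ convergence to the profile in similarity variables) and it removes the v2 overkill: the old
  extraction stub had to CREATE discrete self-similarity out of a bare Type-I blow-up (no print road — J caveat (i));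
  the new second stub only has to show that the GIVEN limit is an ancient rung profile (closure/compactness at fixed `L`,
  the rung analogue of KNSS 2009 Lemma 6.1 / proof of Thm 6.2; tree precedents `HasTypeIDecay.of_tendsto`,
  `rotatedDSS_Iio_of_tendsto`, `IsRungSolutionOn.nsRescale`, `IsClassicalNSSolutionOn.nsRescale_translate`).
Decomposition: `RungBlowupCofinal ⇐ [∃ cofinally many rungs with a forward DSS-tangent blow-up] ∧ [tangent closure]`.
Stubs (3): `stub_forward_dss_blowup_cofinal` (XL, the physics bet of K1), `stub_bc5_rung_two_forward_dss_blowup`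
(BC5 plan-only first rung, cell-free form; the cell-specific rung of record is bc5w's `HalfTurn.stub_bc5_halfturn_two`
once that line is registered), `stub_tangent_flow_closure` (L). Sorries ONLY inside `stub_*`; the composition
`RungBlowupCofinal_of` is a real proof concluding `Goal` (audit shape A12: the only theorem concluding the crux constant
BY NAME is the hypothesis-free `RungBlowupCofinal_skeleton`). New decl names throughout, so the junk record of v2
(`RungForwardTypeIBlowup`, by name, p475616) stays unambiguous. MODEL evidence of record for the cheapest instances is
unchanged (MECHTOY-AGL-1 j256719: m = 0, A ≤ 1000 REGULAR 12/12; AGL-T3-1 j262343 pending) and decides nothing here.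

RELATION TO THE SUP-NORM FORM (DIRECTOR-NS g6 #6 (2) «forward letter = sup-norm Type-I ∧ R2 (∧ R1)»). R2 on `[0,T) × ℝ³`
IMPLIES the sup-norm clause `IsTypeIBlowup u T` (real proof `isTypeIBlowup_of_envelope` below: `C/(‖x‖+√(T−t)) ≤ |C|/√(T−t)`
and `Ico 0 T ∈ 𝓝[<] T`), so the sup-norm conjunct is a CONSEQUENCE of this letter and is not repeated in it; R2 is global
(every `x`), never a centre-only/local weakening. Against bc5w's cell-specific letter `HalfTurn.HalfTurnForwardBlowup L`
(v3 = v2 ∧ R2 by the same ruling): `HalfTurnForwardBlowup L ∧ R1 ∧ (tangent clause)` gives `RungForwardDSSBlowup L` by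
projection; the two lines stay ALTERNATIVE skeletons of the one crux (the rung of record for the tribunal fit-note is
`HalfTurn.stub_bc5_halfturn_two`; `stub_bc5_rung_two_forward_dss_blowup` here is its cell-free form).

TYPING FACTS OF RECORD about the crux letter `RungIsSingular` (refuter5 K5-36 (4); DIRECTOR-NS g6 #3 (4)): (i) it carries
NO defect bound, NO amplitude floor and NO non-axisymmetry clause — those live in K2's window letter and K3's output;
(ii) rung `0` is false on paper (a level-0 band-limited slice is rotation-invariant, `u = f(r)·x̂`, and divergence-free with
Type-I decay forces `f = 0`), so the instance `L₀ = 0` of K1 is served by higher rungs only; (iii) an AXISYMMETRIC (`m = 0`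
about some axis) rung profile WOULD witness K1 as typed but can never feed K3 (`LimitTransfer`'s nontrivial limit would be
an axisymmetric Type-I rotated-DSS ancient mild solution, excluded by tree `not_isAxisymmetric_typeI_rdss_profile`,
p466949) — so the prover of stub 1 / the BC5 stub should AIM at a non-axisymmetric cell (bc5w's half-turn cell with a
triaxial germ) although this letter does not demand it, and the census never counts an `m = 0` run as K2→K3 evidence;
(iv) the tangent field `v` inherits every CLOSED linear symmetry of `u` (cell conditions pass to pointwise limits), which
is how a cell-specific line refines this one.
WHAT THIS IS NOT: not NS — a registered plan about the truncations `NS_L`; nothing is proved about Navier–Stokes. -/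

set_option linter.dupNamespace false

namespace Summit.NavierStokesRegularity.NavierStokesRegularity.Cruxes.RungBlowupCofinal.Birth

/-- The crux behind a local abbreviation (audit shape): `RungBlowupCofinal_of` concludes `Goal`. -/
abbrev Goal : Prop := Summit.NavierStokesRegularity.NavierStokesRegularity.Theses.AngularGalerkinLadder.RungBlowupCofinal

open scoped Topology
open Filter Set MeasureTheory
open Summit.NavierStokesRegularity.FluidComputer
open Literature.Analysis.FluidPDE

local notation "ℝ³" => EuclideanSpace ℝ (Fin 3)

/-- **Forward rung blow-up WITH ITS TANGENT FLOW — the data predicate** (v4 letter, KJ-18 repairs R1 ∧ R2 built in).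
`(u, p, d)` is a rung-`L` solution (`ν = 1`) of the Cauchy problem on `[0, T)` from a smooth rapidly decaying datum,
with finite energy on every slice (R1), inside the origin-centred Type-I envelope with constant `C` (R2), unbounded,
and along the scales `lam n → 0` its Leray rescalings about `(T, 0)` converge pointwise on the open past to the field
`v`, which is rotated-DSS with factor `c > 1` and rotation `R` and is not identically zero on the past. -/
def IsForwardDSSBlowup (L : ℕ) (T C c : ℝ) (R : ℝ³ ≃ₗᵢ[ℝ] ℝ³)
    (u : ℝ → ℝ³ → ℝ³) (p : ℝ → ℝ³ → ℝ) (d : ℝ → ℝ³ → ℝ³) (v : ℝ → ℝ³ → ℝ³) (lam : ℕ → ℝ) : Prop :=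
  0 < T ∧
    AngularLadder.IsRungSolutionOn (Set.Ico 0 T) 1 L u p d ∧
    ContDiff ℝ (⊤ : ℕ∞) (u 0) ∧ HasRapidSpatialDecay (u 0) ∧
    (∀ t ∈ Set.Ico 0 T, MemLp (u t) 2 (volume : Measure ℝ³)) ∧
    (∀ t ∈ Set.Ico 0 T, ∀ x, ‖u t x‖ ≤ C / (‖x‖ + Real.sqrt (T - t))) ∧
    (¬ ∃ M : ℝ, ∀ t ∈ Set.Ico 0 T, ∀ x, ‖u t x‖ ≤ M) ∧
    1 < c ∧ IsRotatedDSS c R v ∧ (∃ s < 0, ∃ y, v s y ≠ 0) ∧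
    (∀ n, 0 < lam n) ∧ Tendsto lam atTop (𝓝 0) ∧
    ∀ s < 0, ∀ y, Tendsto (fun n => nsRescale (lam n) (fun t x => u (T + t) x) s y) atTop (𝓝 (v s y))

/-- **FORWARD DSS-TANGENT RUNG BLOW-UP at level `L`** (the v4 forward letter): some rung-`L` Cauchy solution from smooth
rapidly decaying band-limited data blows up at the centre at a finite time, finite-energy and Type-I in the centred
envelope, with a nontrivial rotated-DSS tangent flow. -/
def RungForwardDSSBlowup (L : ℕ) : Prop :=
  ∃ (T C c : ℝ) (R : ℝ³ ≃ₗᵢ[ℝ] ℝ³) (u : ℝ → ℝ³ → ℝ³) (p : ℝ → ℝ³ → ℝ) (d : ℝ → ℝ³ → ℝ³)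
    (v : ℝ → ℝ³ → ℝ³) (lam : ℕ → ℝ), IsForwardDSSBlowup L T C c R u p d v lam

/-- stub 1 (XL, the physics bet of K1, v4 letter): forward DSS-tangent blow-up of the rung Cauchy problem occurs on a
cofinal set of rungs (strain self-amplification in the low isotypes continued up the ladder). Why it might fail: every
rung may be regular from finite-energy data, or blow up only off-centre / non-Type-I / with a non-self-similar tangent. -/
theorem stub_forward_dss_blowup_cofinal : ∀ L₀ : ℕ, ∃ L ≥ L₀, RungForwardDSSBlowup L := by
  sorry

/-- BC5 FIRST RUNG (plan-only witness, T3; cell-free form): forward DSS-tangent blow-up of RUNG TWO from smooth rapidly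
decaying band-limited finite-energy data — the lowest rung containing the restricted-Euler strain sector. Technique:
Chen–Hou-type computer-assisted profile (steady or precessing state of the similarity dynamics of the radial rung-2
system) + linearised stability + truncation to finite energy, which yields R1, R2 and the tangent clause at once; the
cell of record is bc5w's half-turn cell (HOME/ns-agl-bc5w-19959/RUNG-HALFTURN.md; `HalfTurn.stub_bc5_halfturn_two`).
Outside S's known regime: nothing is proved about blow-up of `NS_L` for any `L ≥ 2`; exercises the route's lever (the
ladder's lowest nonlinear rung). MODEL evidence (not a proof, not a refutation): MECHTOY-AGL-1 j256719 — cheapest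
instances (m = 0, A ≤ 1000) REGULAR 12/12; A ≥ 3000 pending (AGL-T3-1 j262343). -/
theorem stub_bc5_rung_two_forward_dss_blowup : RungForwardDSSBlowup 2 := by
  sorry

/-- stub 2 (L): **tangent-flow closure at fixed `L`** — the pointwise blow-up limit `v` of a finite-energy, centred
Type-I rung-`L` solution is an ancient rung-`L` solution on `(−∞, 0)` (for some pressure `q` and co-band-limited defect
`e`) inside the same Type-I envelope. Print road: KNSS 2009 Lemma 6.1 / proof of Thm 6.2 run for the truncation `NS_L`
(uniform Type-I bounds ⇒ local parabolic regularity of `NS_L` at fixed `L`, `Π_L` being `L^p`-bounded and commuting with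
`Δ` ⇒ `C^k_loc` compactness ⇒ the identity and the (co-)band-limited slice conditions pass to the limit; the envelope by
`HasTypeIDecay.of_tendsto`-type pointwise estimates). Why it might fail: only through a typing gap (e.g. the pressure
gauge of `IsRungSolutionOn`), not in substance. -/
theorem stub_tangent_flow_closure :
    ∀ (L : ℕ) (T C c : ℝ) (R : ℝ³ ≃ₗᵢ[ℝ] ℝ³) (u : ℝ → ℝ³ → ℝ³) (p : ℝ → ℝ³ → ℝ) (d : ℝ → ℝ³ → ℝ³)
      (v : ℝ → ℝ³ → ℝ³) (lam : ℕ → ℝ), IsForwardDSSBlowup L T C c R u p d v lam →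
      ∃ (q : ℝ → ℝ³ → ℝ) (e : ℝ → ℝ³ → ℝ³),
        AngularLadder.IsRungSolutionOn (Set.Iio 0) 1 L v q e ∧ HasTypeIDecay C v := by
  sorry

/-- The crux from the two stubs (real proof): pick a cofinal rung with a forward DSS-tangent blow-up, close its tangent
flow into an ancient rung profile, read off `RungIsSingular`. -/
theorem RungBlowupCofinal_of
    (h1 : ∀ L₀ : ℕ, ∃ L ≥ L₀, RungForwardDSSBlowup L)
    (h2 : ∀ (L : ℕ) (T C c : ℝ) (R : ℝ³ ≃ₗᵢ[ℝ] ℝ³) (u : ℝ → ℝ³ → ℝ³) (p : ℝ → ℝ³ → ℝ)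
      (d : ℝ → ℝ³ → ℝ³) (v : ℝ → ℝ³ → ℝ³) (lam : ℕ → ℝ), IsForwardDSSBlowup L T C c R u p d v lam →
      ∃ (q : ℝ → ℝ³ → ℝ) (e : ℝ → ℝ³ → ℝ³),
        AngularLadder.IsRungSolutionOn (Set.Iio 0) 1 L v q e ∧ HasTypeIDecay C v) : Goal := by
  show Summit.NavierStokesRegularity.NavierStokesRegularity.Theses.AngularGalerkinLadder.RungBlowupCofinal
  intro L₀
  obtain ⟨L, hL, T, C, c, R, u, p, d, v, lam, hF⟩ := h1 L₀
  obtain ⟨q, e, hsol, hI⟩ := h2 L T C c R u p d v lam hF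
  obtain ⟨-, -, -, -, -, -, -, hc, hdss, hnz, -⟩ := hF
  exact ⟨L, hL, C, c, R, v, q, e, ⟨hsol, hc, hdss, hI⟩, hnz⟩

/-- **Which instances of the crux the BC5 rung settles** (real proof from the BC5 stub and the closure stub): a forward
DSS-tangent blow-up of rung two yields `RungIsSingular 2`, hence every instance `L₀ ≤ 2` of K1. -/
theorem rungBlowupCofinal_instances_le_two
    (h5 : RungForwardDSSBlowup 2)
    (h2 : ∀ (L : ℕ) (T C c : ℝ) (R : ℝ³ ≃ₗᵢ[ℝ] ℝ³) (u : ℝ → ℝ³ → ℝ³) (p : ℝ → ℝ³ → ℝ)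
      (d : ℝ → ℝ³ → ℝ³) (v : ℝ → ℝ³ → ℝ³) (lam : ℕ → ℝ), IsForwardDSSBlowup L T C c R u p d v lam →
      ∃ (q : ℝ → ℝ³ → ℝ) (e : ℝ → ℝ³ → ℝ³),
        AngularLadder.IsRungSolutionOn (Set.Iio 0) 1 L v q e ∧ HasTypeIDecay C v) :
    ∀ L₀ ≤ 2, ∃ L ≥ L₀, AngularLadder.RungIsSingular L := by
  intro L₀ hL₀
  obtain ⟨T, C, c, R, u, p, d, v, lam, hF⟩ := h5
  obtain ⟨q, e, hsol, hI⟩ := h2 2 T C c R u p d v lam hF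
  obtain ⟨-, -, -, -, -, -, -, hc, hdss, hnz, -⟩ := hF
  exact ⟨2, hL₀, C, c, R, v, q, e, ⟨hsol, hc, hdss, hI⟩, hnz⟩

/-- The instances `L₀ ≤ 2`, consuming the stubs (carries their `sorry`s). -/
theorem rungBlowupCofinal_instances_le_two_skeleton : ∀ L₀ ≤ 2, ∃ L ≥ L₀, AngularLadder.RungIsSingular L :=
  rungBlowupCofinal_instances_le_two stub_bc5_rung_two_forward_dss_blowup stub_tangent_flow_closure

/-- The hypothesis-free skeleton line: carries the stubs' `sorry`s — decoration, not closure. -/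
theorem RungBlowupCofinal_skeleton :
    Summit.NavierStokesRegularity.NavierStokesRegularity.Theses.AngularGalerkinLadder.RungBlowupCofinal :=
  RungBlowupCofinal_of stub_forward_dss_blowup_cofinal stub_tangent_flow_closure

/-! ## Sanity (real proofs, no stubs): the v4 letter implies the sup-norm Type-I clause and is NOT inhabited by the
KJ-18 / KJ-20 witness classes. -/

/-- R2 ⇒ the sup-norm Type-I clause of the v2 / HalfTurn letters (`IsTypeIBlowup u T`): the centred envelope is a
STRENGTHENING of, never a local substitute for, the sup-norm rate (DIRECTOR-NS g6 #6 (2)). -/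
theorem isTypeIBlowup_of_envelope {T C : ℝ} {u : ℝ → ℝ³ → ℝ³} (hT : 0 < T)
    (hR2 : ∀ t ∈ Set.Ico 0 T, ∀ x, ‖u t x‖ ≤ C / (‖x‖ + Real.sqrt (T - t))) :
    IsTypeIBlowup u T := by
  refine ⟨|C|, ?_⟩
  filter_upwards [Ico_mem_nhdsLT hT] with t ht x
  have hs : 0 < Real.sqrt (T - t) := Real.sqrt_pos.2 (by linarith [ht.2])
  have hden : Real.sqrt (T - t) ≤ ‖x‖ + Real.sqrt (T - t) := by linarith [norm_nonneg x]
  have hden' : 0 < ‖x‖ + Real.sqrt (T - t) := lt_of_lt_of_le hs hden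
  calc ‖u t x‖ ≤ C / (‖x‖ + Real.sqrt (T - t)) := hR2 t ht x
    _ ≤ |C| / (‖x‖ + Real.sqrt (T - t)) := by
        exact div_le_div_of_nonneg_right (le_abs_self C) hden'.le
    _ ≤ |C| / Real.sqrt (T - t) := by
        exact div_le_div_of_nonneg_left (abs_nonneg C) hs hden

/-- Hence every forward DSS-tangent rung blow-up is a sup-norm Type-I blow-up at time `T`. -/
theorem IsForwardDSSBlowup.isTypeIBlowup {L : ℕ} {T C c : ℝ} {R : ℝ³ ≃ₗᵢ[ℝ] ℝ³} {u : ℝ → ℝ³ → ℝ³}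
    {p : ℝ → ℝ³ → ℝ} {d : ℝ → ℝ³ → ℝ³} {v : ℝ → ℝ³ → ℝ³} {lam : ℕ → ℝ}
    (h : IsForwardDSSBlowup L T C c R u p d v lam) : IsTypeIBlowup u T :=
  isTypeIBlowup_of_envelope h.1 h.2.2.2.2.2.1


/-- A field inside the centred Type-I envelope tends to `0` at spatial infinity on every slice — so no spatially
constant non-zero slice (the drift `a(t)·e₀`) and no polynomially growing slice (linear strain flows `A(t)x`) fits R2. -/
theorem envelope_forces_spatial_decay {T C : ℝ} {u : ℝ → ℝ³ → ℝ³} {t : ℝ} (ht : t ∈ Set.Ico 0 T)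
    (hR2 : ∀ t ∈ Set.Ico 0 T, ∀ x, ‖u t x‖ ≤ C / (‖x‖ + Real.sqrt (T - t))) :
    Tendsto (fun x : ℝ³ => ‖u t x‖) (Filter.comap (fun x : ℝ³ => ‖x‖) atTop) (𝓝 0) := by
  have hTt : 0 < Real.sqrt (T - t) := Real.sqrt_pos.2 (by linarith [ht.2])
  -- the envelope `C / (‖x‖ + √(T−t))` tends to 0 along ‖x‖ → ∞
  have henv : Tendsto (fun x : ℝ³ => C / (‖x‖ + Real.sqrt (T - t)))
      (Filter.comap (fun x : ℝ³ => ‖x‖) atTop) (𝓝 0) := by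
    have h1 : Tendsto (fun r : ℝ => C / (r + Real.sqrt (T - t))) atTop (𝓝 0) := by
      apply Tendsto.div_atTop tendsto_const_nhds
      exact tendsto_atTop_add_const_right _ _ tendsto_id
    exact h1.comp tendsto_comap
  refine squeeze_zero' (Eventually.of_forall fun x => norm_nonneg _) ?_ henv
  exact Eventually.of_forall fun x => hR2 t ht x

end Summit.NavierStokesRegularity.NavierStokesRegularity.Cruxes.RungBlowupCofinal.Birth
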